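import Mathlib.Algebra.Ring.GeomSum
import Literature.Computability.AlgebraicComplexity.Yab15BRank
import Literature.Computability.AlgebraicComplexity.LandsbergRessayreNormalForm
import HarnessLib

/-!
# Yabe 2015, Proposition 5.2 — `brank(p_{A,2k,n-1}) ≤ n + 2(k-1)D^{k-1}` (proof)

Topic `Literature/Computability/AlgebraicComplexity`; sibling proofs file of `Yab15BRank.lean`
(A. Yabe, *Bi-polynomial rank and determinantal complexity*, arXiv:1504.00151, typed by val-lit
t17). This file DISCHARGES `yabe2015_prop_5_2` ("the essence of our result", p0011): for an
`n × n` matrix `A` of homogeneous linear forms in `D` variables,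
`brank((det(A(x) + Λ_n^{n-1}))^{(2k)}) ≤ n + 2(k-1)D^{k-1}` (`k ≥ 1`).

## Proof (an algebraic reorganisation of the paper's §5.1)

The paper proves this with Mahajan–Vinay clow sequences (Lemmas 5.4–5.7). We obtain the SAME
decomposition of `p_{A,2k} = (det(A + Λ_n^{n-1}))^{(2k)}` by linear algebra in the polynomial ring.
Write `A + Λ_n^{n-1} = [[a, bᵀ], [c, 1 + N]]` (`a = A₀₀`, `N` the lower `(n-1) × (n-1)` block) and
expand column `0` as `(a, c) = (a - bᵀs, 0) + Σ_j s_j · col_{j+1} + (0, (-N)^{2k} c)` with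
`s = Σ_{j<2k} (-N)^j c` (so `(1 + N) s = c - (-N)^{2k} c`). By multilinearity the middle summand
contributes `0`, the last one only terms of degree `> 2k`, and the first one `(a - bᵀs) · det(1+N)`.
Taking degree-`2k` parts (`e_i = (det(1 + N))^{(i)}`):

  `p_{A,2k} = a · e_{2k-1} - Σ_{j ≤ 2k-2} (-1)^j (bᵀ N^j c) · e_{2k-2-j}`,

which is Yabe's decomposition `p_{A,2k} = ± Σ_t q_{A,2k,t}` by the length `t = j + 2` of the clow
through vertex `1` (Lemma 5.7): the term `j = 2k-2` is `bᵀ N^{2k-2} c = Σ_v (bᵀN^{k-1})_v (N^{k-1}c)_v`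
(`brank ≤ n - 1`, Lemma 5.7 (i)), the term `j = k - 2` is a product of two degree-`k` forms
(`brank ≤ 1`), and every other term is (degree `t'`) × (degree `2k - t'`) with `1 ≤ t' < k`, of
`brank ≤ s_{k-t'} ≤ D^{k-1}` by splitting the longer factor along degree-`(k-t')` monomials
(Lemma 5.6 / 5.7 (ii)). Summing: `brank ≤ (n-1) + 1 + s_{k-1} + (2k-3)D^{k-1} ≤ n + 2(k-1)D^{k-1}`.

Honest framing: bookkeeping of a published argument; nothing here bears on `VP ≠ VNP`.

## References

* [Yabe2015] A. Yabe, *Bi-polynomial rank and determinantal complexity*, arXiv:1504.00151 (2015),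
  Prop. 5.2 (p. 11) and §5.1 (pp. 12–15, Lemmas 5.4–5.7).
-/

noncomputable section

open MvPolynomial Matrix Finset

namespace Literature.Computability.AlgebraicComplexity

universe u v

namespace Yabe

variable {K : Type u} [Field K] {σ : Type v}

/-! ### Graded components of products with a homogeneous factor -/

/-- `(f g)^{(d)} = f · g^{(d - t)}` for `f` homogeneous of degree `t ≤ d` (the degree bookkeeping
behind Yabe's `p_{A,k,r} := (det(A + Λ_n^r))^{(k)}` and `a_C ∈ K[x]^{(k)}`, §5–§5.1).
[cite: Yabe2015, §5.1 (degrees of a_C)] -/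
theorem homogeneousComponent_mul_left {f g : MvPolynomial σ K} {t d : ℕ} (hf : f.IsHomogeneous t)
    (htd : t ≤ d) : homogeneousComponent d (f * g) = f * homogeneousComponent (d - t) g := by
  classical
  ext m
  rw [coeff_homogeneousComponent, coeff_mul, coeff_mul]
  have key : ∀ ab ∈ Finset.antidiagonal m,
      coeff ab.1 f * coeff ab.2 (homogeneousComponent (d - t) g) =
        if m.degree = d then coeff ab.1 f * coeff ab.2 g else 0 := by
    rintro ⟨a, b⟩ hab
    rw [Finset.mem_antidiagonal] at hab
    rw [coeff_homogeneousComponent]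
    by_cases ha : a.degree = t
    · have hdb : m.degree = t + b.degree := by rw [← hab, map_add, ha]
      by_cases hb : b.degree = d - t
      · rw [if_pos hb, if_pos (by rw [hdb, hb]; omega)]
      · rw [if_neg hb, if_neg (fun h => hb (by rw [hdb] at h; omega)), mul_zero]
    · simp only [hf.coeff_eq_zero ha, zero_mul, ite_self]
  rw [Finset.sum_congr rfl key]
  split_ifs with hd
  · rfl
  · simp

/-- `(f g)^{(d)} = 0` for `f` homogeneous of degree `t > d` (degree bookkeeping of Yabe 2015,
§5.1). [cite: Yabe2015, §5.1 (degrees of a_C)] -/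
theorem homogeneousComponent_mul_eq_zero_of_lt {f g : MvPolynomial σ K} {t d : ℕ}
    (hf : f.IsHomogeneous t) (hdt : d < t) : homogeneousComponent d (f * g) = 0 := by
  classical
  ext m
  rw [coeff_homogeneousComponent, coeff_mul, coeff_zero]
  split_ifs with hd
  · refine Finset.sum_eq_zero ?_
    rintro ⟨a, b⟩ hab
    rw [Finset.mem_antidiagonal] at hab
    by_cases ha : a.degree = t
    · exfalso
      have h := congrArg Finsupp.degree hab
      rw [map_add, ha, hd] at h
      omega
    · rw [hf.coeff_eq_zero ha, zero_mul]
  · rfl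

/-! ### `brank` bookkeeping: zero, sums, scalars, products -/

variable [DecidableEq σ]

omit [DecidableEq σ] in
/-- `brank(0) = 0` (the empty decomposition). [cite: Yabe2015, Definition 1.4] -/
theorem bRank_zero (k : ℕ) : bRank k (0 : MvPolynomial σ K) = 0 :=
  Nat.eq_zero_of_le_zero (by
    simpa using bRank_le_of_eq_sum (p := (0 : MvPolynomial σ K)) (k := k)
      (fun i : Fin 0 => (0 : MvPolynomial σ K)) (fun _ => 0) (fun _ => isHomogeneous_zero _ _ _)
      (fun _ => isHomogeneous_zero _ _ _) (by simp))

/-- Subadditivity: `brank(p + q) ≤ brank(p) + brank(q)` for `p, q` homogeneous of degree `2k`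
(concatenate optimal decompositions; Yabe 2015, proof of Lemma 5.3 / Prop. 5.2).
[cite: Yabe2015, Lemma 5.3 (proof)] -/
theorem bRank_add_le {k : ℕ} {p q : MvPolynomial σ K} (hp : p.IsHomogeneous (2 * k))
    (hq : q.IsHomogeneous (2 * k)) : bRank k (p + q) ≤ bRank k p + bRank k q := by
  obtain ⟨f, g, hf, hg, hfg⟩ := exists_eq_sum_mul_of_isHomogeneous hp
  obtain ⟨f', g', hf', hg', hfg'⟩ := exists_eq_sum_mul_of_isHomogeneous hq
  have h := bRank_le_of_eq_sum (k := k) (p := p + q) (Sum.elim f f') (Sum.elim g g')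
    (fun i => by
      rcases i with i | i
      · exact hf i
      · exact hf' i)
    (fun i => by
      rcases i with i | i
      · exact hg i
      · exact hg' i)
    (by rw [Fintype.sum_sum_type]; simp only [Sum.elim_inl, Sum.elim_inr]; rw [← hfg, ← hfg'])
  simpa using h

/-- Subadditivity over a finite sum of degree-`2k` forms. [cite: Yabe2015, Lemma 5.3 (proof)] -/
theorem bRank_sum_le {k : ℕ} {ι : Type*} (s : Finset ι) (p : ι → MvPolynomial σ K)
    (hp : ∀ i ∈ s, (p i).IsHomogeneous (2 * k)) :
    bRank k (∑ i ∈ s, p i) ≤ ∑ i ∈ s, bRank k (p i) := by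
  classical
  induction s using Finset.induction_on with
  | empty => simp [bRank_zero]
  | insert a s ha ih =>
      rw [Finset.sum_insert ha, Finset.sum_insert ha]
      have hs : ∀ i ∈ s, (p i).IsHomogeneous (2 * k) := fun i hi => hp i (Finset.mem_insert_of_mem hi)
      exact (bRank_add_le (hp a (Finset.mem_insert_self a s)) (IsHomogeneous.sum s p _ hs)).trans
        (Nat.add_le_add_left (ih hs) _)

/-- Scalars do not increase `brank`: `brank(c · p) ≤ brank(p)`. [cite: Yabe2015, Definition 1.4] -/
theorem bRank_C_mul_le {k : ℕ} (c : K) {p : MvPolynomial σ K} (hp : p.IsHomogeneous (2 * k)) :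
    bRank k (C c * p) ≤ bRank k p := by
  obtain ⟨f, g, hf, hg, hfg⟩ := exists_eq_sum_mul_of_isHomogeneous hp
  have h := bRank_le_of_eq_sum (k := k) (p := C c * p) (fun i => C c * f i) g
    (fun i => by simpa using (isHomogeneous_C σ c).mul (hf i)) hg
    (by
      conv_lhs => rw [hfg]
      rw [Finset.mul_sum]
      exact Finset.sum_congr rfl fun i _ => (mul_assoc _ _ _).symm)
  simpa using h

omit [DecidableEq σ] in
/-- A single product of two degree-`k` forms has `brank ≤ 1`. [cite: Yabe2015, Definition 1.4] -/
theorem bRank_mul_le_one {k : ℕ} {f g : MvPolynomial σ K} (hf : f.IsHomogeneous k)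
    (hg : g.IsHomogeneous k) : bRank k (f * g) ≤ 1 := by
  have h := bRank_le_of_eq_sum (k := k) (p := f * g) (fun _ : Fin 1 => f) (fun _ => g) (fun _ => hf)
    (fun _ => hg) (by simp)
  simpa using h

/-- Every exponent vector of degree `≥ j` dominates one of degree exactly `j`. [folklore] -/
private theorem exists_le_degree_eq' (m : σ →₀ ℕ) :
    ∀ j : ℕ, j ≤ m.degree → ∃ I : σ →₀ ℕ, I ≤ m ∧ I.degree = j
  | 0, _ => ⟨0, bot_le, by simp⟩
  | j + 1, hj => by
      obtain ⟨I, hIm, hIj⟩ := exists_le_degree_eq' m j (Nat.le_of_succ_le hj)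
      have hne : I ≠ m := by rintro rfl; omega
      obtain ⟨s, hs⟩ : ∃ s, I s < m s := by
        by_contra h
        simp only [not_exists, not_lt] at h
        exact hne (le_antisymm hIm (Finsupp.le_def.2 h))
      refine ⟨I + Finsupp.single s 1, Finsupp.le_def.2 fun t => ?_, by simp [hIj]⟩
      by_cases hts : t = s
      · subst hts; simp; omega
      · have h0 : Finsupp.single s 1 t = 0 := Finsupp.single_eq_of_ne hts
        simp only [Finsupp.add_apply, h0, add_zero]
        exact Finsupp.le_def.1 hIm t

/-- **Splitting a product along monomials** (Yabe 2015, Lemma 5.6 as used in Lemma 5.7 (ii)): if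
`f` is homogeneous of degree `t ≤ k` and `g` of degree `u` with `t + u = 2k`, then
`f g = Σ_I (f · x^I) · g_I` over the degree-`(k-t)` monomials `x^I`, so
`brank(f g) ≤ s_{k-t} = |𝓘_{k-t}|`. [cite: Yabe2015, Lemma 5.6] -/
theorem bRank_mul_le_card_degMonomials [Fintype σ] {k t u : ℕ} {f g : MvPolynomial σ K}
    (hf : f.IsHomogeneous t) (hg : g.IsHomogeneous u) (htu : t + u = 2 * k) (ht : t ≤ k) :
    bRank k (f * g) ≤ (degMonomials σ (k - t)).card := by
  classical
  have hdeg : ∀ m ∈ g.support, m.degree = u := fun m hm => by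
    by_contra h
    exact (mem_support_iff.1 hm) (hg.coeff_eq_zero h)
  have hex : ∀ m : σ →₀ ℕ, ∃ I : σ →₀ ℕ, m ∈ g.support → I ≤ m ∧ I.degree = k - t := fun m => by
    by_cases hm : m ∈ g.support
    · obtain ⟨I, hI⟩ := exists_le_degree_eq' m (k - t) (by rw [hdeg m hm]; omega)
      exact ⟨I, fun _ => hI⟩
    · exact ⟨0, fun h => (hm h).elim⟩
  choose half hhalf using hex
  have hmaps : ∀ m ∈ g.support, half m ∈ degMonomials σ (k - t) := fun m hm =>
    mem_degMonomials_iff.2 (hhalf m hm).2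
  set F : DegIdx σ (k - t) → MvPolynomial σ K := fun I => f * monomial I.1 1 with hF
  set G : DegIdx σ (k - t) → MvPolynomial σ K := fun I =>
    ∑ m ∈ g.support with half m = I.1, monomial (m - I.1) (coeff m g) with hG
  have hg' : g = ∑ I : DegIdx σ (k - t), monomial I.1 (1 : K) * G I := by
    have h1 : ∀ I : DegIdx σ (k - t), monomial I.1 (1 : K) * G I =
        ∑ m ∈ g.support with half m = I.1, monomial m (coeff m g) := fun I => by
      rw [hG, Finset.mul_sum]
      refine Finset.sum_congr rfl fun m hm => ?_
      obtain ⟨hm, hI⟩ := Finset.mem_filter.1 hm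
      rw [monomial_mul, one_mul, ← hI, add_tsub_cancel_of_le (hhalf m hm).1]
    calc g = ∑ m ∈ g.support, monomial m (coeff m g) := g.as_sum
      _ = ∑ I ∈ degMonomials σ (k - t), ∑ m ∈ g.support with half m = I, monomial m (coeff m g) :=
          (Finset.sum_fiberwise_of_maps_to hmaps _).symm
      _ = ∑ I : DegIdx σ (k - t), ∑ m ∈ g.support with half m = I.1, monomial m (coeff m g) :=
          (Finset.sum_coe_sort (degMonomials σ (k - t))
            (fun I => ∑ m ∈ g.support with half m = I, monomial m (coeff m g))).symm
      _ = _ := Finset.sum_congr rfl fun I _ => (h1 I).symm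
  have hFG : f * g = ∑ I, F I * G I := by
    conv_lhs => rw [hg']
    rw [Finset.mul_sum]
    exact Finset.sum_congr rfl fun I _ => by rw [hF, mul_assoc]
  calc bRank k (f * g) ≤ Fintype.card (DegIdx σ (k - t)) :=
        bRank_le_of_eq_sum F G
          (fun I => by
            have h := hf.mul (isHomogeneous_monomial (R := K) (d := I.1) 1 (mem_degMonomials_iff.1 I.2))
            rwa [show t + (k - t) = k by omega] at h)
          (fun I => IsHomogeneous.sum _ _ _ fun m hm => by
            obtain ⟨hm, hI⟩ := Finset.mem_filter.1 hm
            refine isHomogeneous_monomial _ ?_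
            have h := congrArg Finsupp.degree (add_tsub_cancel_of_le (hhalf m hm).1)
            rw [map_add, (hhalf m hm).2, hdeg m hm] at h
            rw [← hI]
            omega)
          hFG
    _ = (degMonomials σ (k - t)).card := by simp

/-! ### Homogeneity of matrix powers and bilinear pairings of linear forms -/

omit [DecidableEq σ] in
/-- Entries of `N^j` are homogeneous of degree `j` when those of `N` are linear forms (Yabe 2015,
Lemma 5.7 (proof): `a_R := Π_i a_{u_i u_{i+1}}` is a form of degree `k`).
[cite: Yabe2015, Lemma 5.7 (proof)] -/
theorem isHomogeneous_pow_apply {m : Type*} [Fintype m] [DecidableEq m]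
    {N : Matrix m m (MvPolynomial σ K)} (hN : ∀ i j, (N i j).IsHomogeneous 1) (e : ℕ) (a b : m) :
    ((N ^ e) a b).IsHomogeneous e := by
  induction e generalizing a b with
  | zero =>
      rw [pow_zero, Matrix.one_apply]
      split_ifs
      · exact isHomogeneous_one σ K
      · exact isHomogeneous_zero σ K 0
  | succ j ih =>
      rw [pow_succ, Matrix.mul_apply]
      exact IsHomogeneous.sum _ _ _ fun l _ => (ih a l).mul (hN l b)

omit [DecidableEq σ] in
/-- `M v` has homogeneous entries of degree `s + t` if `M` has degree-`s` and `v` degree-`t` entries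
(Yabe 2015, Lemma 5.7 (proof): path sums `Σ_R a_R` are forms). [cite: Yabe2015, Lemma 5.7 (proof)] -/
theorem isHomogeneous_mulVec {m m' : Type*} [Fintype m'] {M : Matrix m m' (MvPolynomial σ K)}
    {v : m' → MvPolynomial σ K} {s t : ℕ} (hM : ∀ a b, (M a b).IsHomogeneous s)
    (hv : ∀ b, (v b).IsHomogeneous t) (a : m) : ((M *ᵥ v) a).IsHomogeneous (s + t) :=
  IsHomogeneous.sum _ _ _ fun b _ => (hM a b).mul (hv b)

omit [DecidableEq σ] in
/-- `v M` has homogeneous entries of degree `t + s`. [folklore] -/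
private theorem isHomogeneous_vecMul {m m' : Type*} [Fintype m] {M : Matrix m m' (MvPolynomial σ K)}
    {v : m → MvPolynomial σ K} {s t : ℕ} (hM : ∀ a b, (M a b).IsHomogeneous s)
    (hv : ∀ a, (v a).IsHomogeneous t) (b : m') : ((v ᵥ* M) b).IsHomogeneous (t + s) :=
  IsHomogeneous.sum _ _ _ fun a _ => (hv a).mul (hM a b)

omit [DecidableEq σ] in
/-- A dot product of degree-`s` and degree-`t` vectors is homogeneous of degree `s + t`.
[folklore] -/
private theorem isHomogeneous_dotProduct {m : Type*} [Fintype m] {v w : m → MvPolynomial σ K} {s t : ℕ}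
    (hv : ∀ a, (v a).IsHomogeneous s) (hw : ∀ a, (w a).IsHomogeneous t) :
    (v ⬝ᵥ w).IsHomogeneous (s + t) :=
  IsHomogeneous.sum _ _ _ fun a _ => (hv a).mul (hw a)

omit [DecidableEq σ] in
/-- `(-N)^j v = (-1)^j • N^j v`. [folklore] -/
private theorem neg_pow_mulVec {m : Type*} [Fintype m] [DecidableEq m] (N : Matrix m m (MvPolynomial σ K))
    (j : ℕ) (v : m → MvPolynomial σ K) : (-N) ^ j *ᵥ v = ((-1 : MvPolynomial σ K) ^ j) • (N ^ j *ᵥ v) := by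
  induction j generalizing v with
  | zero => simp
  | succ j ih =>
      rw [pow_succ (-N) j, ← Matrix.mulVec_mulVec, Matrix.neg_mulVec, Matrix.mulVec_neg, ih,
        pow_succ N j, ← Matrix.mulVec_mulVec, pow_succ (-1 : MvPolynomial σ K) j, mul_neg_one,
        neg_smul]

omit [DecidableEq σ] in
/-- The constant term of `det(1 + N)` is `1` when `N` has linear entries. [folklore] -/
private theorem homogeneousComponent_zero_det_one_add {m : Type*} [Fintype m] [DecidableEq m]
    {N : Matrix m m (MvPolynomial σ K)} (hN : ∀ i j, (N i j).IsHomogeneous 1) :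
    homogeneousComponent 0 (1 + N).det = 1 := by
  rw [homogeneousComponent_zero, ← constantCoeff_eq, ← det_constPart]
  have h : constPart (1 + N) = 1 := by
    ext i j
    rw [constPart_apply, Matrix.add_apply, map_add, constantCoeff_eq, (hN i j).coeff_eq_zero (by simp),
      add_zero, Matrix.one_apply, Matrix.one_apply]
    split_ifs <;> simp
  rw [h, Matrix.det_one, map_one]

omit [DecidableEq σ] in
/-- `Σ_j v_j M_{ij} = (M v)_i` (commuting the factors of `Matrix.mulVec`). [folklore] -/
private theorem sum_mul_comm_eq_mulVec {m : Type*} [Fintype m] (M : Matrix m m (MvPolynomial σ K))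
    (v : m → MvPolynomial σ K) (i : m) : ∑ j, v j * M i j = (M *ᵥ v) i :=
  Finset.sum_congr rfl fun _ _ => mul_comm _ _

/-! ### The degree-`2k` part of `det(A + Λ_n^{n-1})` (Yabe 2015, §5.1, Lemmas 5.4–5.5 & 5.7) -/

omit [DecidableEq σ] in
/-- **Yabe's decomposition of `p_{A,2k} = (det(A + Λ_n^{n-1}))^{(2k)}`** (the algebraic content of
Lemmas 5.4–5.5 and 5.7: the terms are indexed by `j + 2 =` the length of the clow through the first
vertex): with `A + Λ = [[a, bᵀ], [c, 1 + N]]` and `e_i = (det(1 + N))^{(i)}`,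
`p_{A,2k} = a · e_{2k-1} - Σ_{j ≤ 2k-2} (-1)^j (bᵀ N^j c) · e_{2k-2-j}`.
[cite: Yabe2015, Lemma 5.5] -/
theorem homogeneousComponent_det_add_lambdaDiag [Fintype σ] {m k : ℕ} (hk : 1 ≤ k)
    (A : Matrix (Fin (m + 1)) (Fin (m + 1)) (MvPolynomial σ K)) (hA : ∀ i j, (A i j).IsHomogeneous 1)
    (N : Matrix (Fin m) (Fin m) (MvPolynomial σ K)) (hN : ∀ i j, N i j = A i.succ j.succ)
    (b c : Fin m → MvPolynomial σ K) (hb : ∀ j, b j = A 0 j.succ) (hc : ∀ i, c i = A i.succ 0) :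
    homogeneousComponent (2 * k) (A + (lambdaDiag K (m + 1) m).map C).det =
      A 0 0 * homogeneousComponent (2 * k - 1) (1 + N).det -
        ∑ j ∈ Finset.range (2 * k - 1), C ((-1 : K) ^ j) *
          ((b ⬝ᵥ ((N ^ j) *ᵥ c)) * homogeneousComponent (2 * k - 2 - j) (1 + N).det) := by
  classical
  set M : Matrix (Fin (m + 1)) (Fin (m + 1)) (MvPolynomial σ K) :=
    A + (lambdaDiag K (m + 1) m).map C with hM
  have hN1 : ∀ i j, (N i j).IsHomogeneous 1 := fun i j => by rw [hN]; exact hA _ _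
  have hb1 : ∀ j, (b j).IsHomogeneous 1 := fun j => by rw [hb]; exact hA _ _
  have hc1 : ∀ i, (c i).IsHomogeneous 1 := fun i => by rw [hc]; exact hA _ _
  -- entries of `M`
  have hΛ : ∀ p q : Fin (m + 1), (lambdaDiag K (m + 1) m) p q =
      if p = q then (if p = 0 then 0 else 1) else 0 := by
    intro p q
    rw [lambdaDiag, Matrix.diagonal_apply]
    by_cases hpq : p = q
    · rw [if_pos hpq, if_pos hpq]
      by_cases hp : p = 0
      · rw [if_pos hp, if_neg]; subst hp; simp
      · rw [if_neg hp, if_pos]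
        have : (p : ℕ) ≠ 0 := fun h => hp (Fin.ext h)
        omega
    · rw [if_neg hpq, if_neg hpq]
  have hM00 : M 0 0 = A 0 0 := by
    rw [hM, Matrix.add_apply, Matrix.map_apply, hΛ]; simp
  have hM0s : ∀ j : Fin m, M 0 j.succ = b j := fun j => by
    rw [hM, Matrix.add_apply, Matrix.map_apply, hΛ, if_neg (Fin.succ_ne_zero j).symm, map_zero,
      add_zero, hb]
  have hMs0 : ∀ i : Fin m, M i.succ 0 = c i := fun i => by
    rw [hM, Matrix.add_apply, Matrix.map_apply, hΛ, if_neg (Fin.succ_ne_zero i), map_zero, add_zero,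
      hc]
  have hMss : ∀ i j : Fin m, M i.succ j.succ = (1 + N) i j := fun i j => by
    rw [hM, Matrix.add_apply, Matrix.map_apply, hΛ, Matrix.add_apply, Matrix.one_apply, hN, add_comm]
    by_cases hij : i = j
    · subst hij; simp
    · rw [if_neg (fun h => hij (Fin.succ_injective _ h)), if_neg hij, map_zero]
  have hsub : ∀ w : Fin (m + 1) → MvPolynomial σ K,
      (M.updateCol 0 w).submatrix Fin.succ Fin.succ = 1 + N := by
    intro w
    ext i j
    rw [Matrix.submatrix_apply, Matrix.updateCol_ne (Fin.succ_ne_zero j), hMss]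
  -- the geometric sum `S = Σ_{j<2k} (-N)^j` and `s = S c`
  set S : Matrix (Fin m) (Fin m) (MvPolynomial σ K) := ∑ j ∈ Finset.range (2 * k), (-N) ^ j with hS
  set s : Fin m → MvPolynomial σ K := S *ᵥ c with hs
  have hgeom : (1 + N) * S = 1 - (-N) ^ (2 * k) := by
    have h := mul_neg_geom_sum (-N) (2 * k)
    rwa [sub_neg_eq_add] at h
  have hcs : (1 + N) *ᵥ s + (-N) ^ (2 * k) *ᵥ c = c := by
    rw [hs, Matrix.mulVec_mulVec, hgeom, Matrix.sub_mulVec, Matrix.one_mulVec, sub_add_cancel]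
  -- column `0` of `M` as `w₁ + w₂ + w₃`
  set w₁ : Fin (m + 1) → MvPolynomial σ K := Pi.single 0 (A 0 0 - b ⬝ᵥ s) with hw₁
  set w₂ : Fin (m + 1) → MvPolynomial σ K :=
    fun p => ∑ q, (Fin.cases (0 : MvPolynomial σ K) s q : MvPolynomial σ K) • M p q with hw₂
  set w₃ : Fin (m + 1) → MvPolynomial σ K :=
    Fin.cases (0 : MvPolynomial σ K) ((-N) ^ (2 * k) *ᵥ c) with hw₃
  have hsb : ∑ j : Fin m, s j * b j = b ⬝ᵥ s := by
    unfold dotProduct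
    exact Finset.sum_congr rfl fun j _ => mul_comm _ _
  have hcol : (fun p => M p 0) = w₁ + w₂ + w₃ := by
    funext p
    refine Fin.cases ?_ (fun i => ?_) p
    · simp only [Pi.add_apply, hw₁, hw₂, hw₃, Pi.single_eq_same, Fin.cases_zero, Fin.cases_succ,
        Fin.sum_univ_succ, hM00, hM0s, smul_eq_mul, hsb]
      ring
    · have h1 : w₁ i.succ = 0 := by simp only [hw₁, Pi.single_eq_of_ne (Fin.succ_ne_zero i)]
      have h2 : w₂ i.succ = ((1 + N) *ᵥ s) i := by
        simp only [hw₂, Fin.sum_univ_succ, Fin.cases_zero, Fin.cases_succ, zero_mul, zero_add,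
          smul_eq_mul, hMss]
        exact sum_mul_comm_eq_mulVec (1 + N) s i
      have h3 : w₃ i.succ = ((-N) ^ (2 * k) *ᵥ c) i := by simp only [hw₃, Fin.cases_succ]
      rw [Pi.add_apply, Pi.add_apply, h1, h2, h3, zero_add, hMs0]
      conv_lhs => rw [← hcs]
      rfl
  -- multilinearity in column `0`
  have hdet : M.det = (M.updateCol 0 w₁).det + (M.updateCol 0 w₂).det + (M.updateCol 0 w₃).det := by
    conv_lhs => rw [← Matrix.updateCol_eq_self M 0, hcol]
    rw [Matrix.det_updateCol_add, Matrix.det_updateCol_add]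
  have hdet₂ : (M.updateCol 0 w₂).det = 0 := by
    rw [hw₂, Matrix.det_updateCol_sum]
    simp only [Fin.cases_zero, zero_smul]
  have hdet₁ : (M.updateCol 0 w₁).det = (A 0 0 - b ⬝ᵥ s) * (1 + N).det := by
    rw [Matrix.det_succ_column_zero, Fin.sum_univ_succ, Matrix.updateCol_self, hw₁,
      Pi.single_eq_same, Fin.succAbove_zero, ← hw₁, hsub, Fin.val_zero, pow_zero, one_mul,
      Finset.sum_eq_zero fun i _ => ?_, add_zero]
    rw [Matrix.updateCol_self, hw₁, Pi.single_eq_of_ne (Fin.succ_ne_zero i), mul_zero, zero_mul]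
  have hdet₃ : homogeneousComponent (2 * k) (M.updateCol 0 w₃).det = 0 := by
    rw [Matrix.det_succ_column_zero, map_sum]
    refine Finset.sum_eq_zero fun i _ => ?_
    rw [Matrix.updateCol_self]
    have hw : (w₃ i).IsHomogeneous (2 * k + 1) := by
      refine Fin.cases ?_ (fun i' => ?_) i
      · simp only [hw₃, Fin.cases_zero]; exact isHomogeneous_zero σ K _
      · simp only [hw₃, Fin.cases_succ]
        exact isHomogeneous_mulVec (isHomogeneous_pow_apply (fun a b => (hN1 a b).neg) _) hc1 i'
    have hC : ((-1 : MvPolynomial σ K) ^ (i : ℕ)) = C ((-1 : K) ^ (i : ℕ)) := by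
      rw [map_pow, map_neg, map_one]
    have hf : ((-1 : MvPolynomial σ K) ^ (i : ℕ) * w₃ i).IsHomogeneous (2 * k + 1) := by
      rw [hC]; simpa using (isHomogeneous_C σ ((-1 : K) ^ (i : ℕ))).mul hw
    exact homogeneousComponent_mul_eq_zero_of_lt hf (by omega)
  have hcomp : homogeneousComponent (2 * k) M.det =
      homogeneousComponent (2 * k) ((A 0 0 - b ⬝ᵥ s) * (1 + N).det) := by
    rw [hdet, map_add, map_add, hdet₂, hdet₃, hdet₁, map_zero, add_zero, add_zero]
  -- expand `bᵀ s = Σ_j (-1)^j bᵀ N^j c` and take degree-`2k` parts termwise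
  have hbs : b ⬝ᵥ s = ∑ j ∈ Finset.range (2 * k), C ((-1 : K) ^ j) * (b ⬝ᵥ (N ^ j *ᵥ c)) := by
    rw [hs, hS, Matrix.sum_mulVec, dotProduct_sum]
    refine Finset.sum_congr rfl fun j _ => ?_
    rw [neg_pow_mulVec, dotProduct_smul, smul_eq_mul, map_pow, map_neg, map_one]
  rw [hcomp, sub_mul, map_sub, homogeneousComponent_mul_left (hA 0 0) (by omega), hbs,
    Finset.sum_mul, map_sum]
  congr 1
  -- the term `j = 2k - 1` has degree `2k + 1` and drops out
  obtain ⟨k', hk'⟩ : ∃ k', 2 * k = (2 * k - 1) + 1 := ⟨2 * k - 1, by omega⟩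
  conv_lhs => rw [hk', Finset.sum_range_succ]
  have hβ : ∀ j : ℕ, (b ⬝ᵥ (N ^ j *ᵥ c)).IsHomogeneous (1 + (j + 1)) := fun j =>
    isHomogeneous_dotProduct hb1 (isHomogeneous_mulVec (isHomogeneous_pow_apply hN1 j) hc1)
  have hlast : homogeneousComponent (2 * k - 1 + 1)
      (C ((-1 : K) ^ (2 * k - 1)) * (b ⬝ᵥ (N ^ (2 * k - 1) *ᵥ c)) * (1 + N).det) = 0 := by
    rw [mul_assoc, homogeneousComponent_C_mul,
      homogeneousComponent_mul_eq_zero_of_lt (hβ (2 * k - 1)) (by omega), mul_zero]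
  rw [hlast, add_zero, ← hk']
  refine Finset.sum_congr rfl fun j hj => ?_
  rw [Finset.mem_range] at hj
  rw [mul_assoc, homogeneousComponent_C_mul, homogeneousComponent_mul_left (hβ j) (by omega),
    show 2 * k - (1 + (j + 1)) = 2 * k - 2 - j from by omega]

/-- `brank(p - q) ≤ brank(p) + brank(q)` for degree-`2k` forms. [cite: Yabe2015, Lemma 5.3 (proof)] -/
theorem bRank_sub_le {k : ℕ} {p q : MvPolynomial σ K} (hp : p.IsHomogeneous (2 * k))
    (hq : q.IsHomogeneous (2 * k)) : bRank k (p - q) ≤ bRank k p + bRank k q := by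
  have hneg : -q = C (-1 : K) * q := by rw [map_neg, map_one, neg_one_mul]
  rw [sub_eq_add_neg]
  refine (bRank_add_le hp (by rw [hneg]; simpa using (isHomogeneous_C σ (-1 : K)).mul hq)).trans ?_
  rw [hneg]
  exact Nat.add_le_add_left (bRank_C_mul_le (-1) hq) _

/-- `s_i ≤ D^j` for `1 ≤ i ≤ j` (`s_i ≤ D^i`, Prop. 2.6, and monotonicity; `D = 0` gives `s_i = 0`).
[cite: Yabe2015, Proposition 2.6] -/
theorem card_degMonomials_le_pow_of_le [Fintype σ] {i j : ℕ} (hi : 1 ≤ i) (hij : i ≤ j) :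
    (degMonomials σ i).card ≤ Fintype.card σ ^ j := by
  refine (card_degMonomials_le_pow σ i).trans ?_
  rcases Nat.eq_zero_or_pos (Fintype.card σ) with h0 | hpos
  · rw [h0, zero_pow (by omega)]; exact Nat.zero_le _
  · exact Nat.pow_le_pow_right hpos hij

omit [DecidableEq σ] in
/-- **Lemma 5.7 (i)**: the top term `bᵀ N^{2k-2} c = Σ_v (bᵀ N^{k-1})_v (N^{k-1} c)_v` has
`brank ≤ n - 1` (the `n - 1` choices of the `(k+1)`-st vertex of a clow of length `2k` through `1`).
[cite: Yabe2015, Lemma 5.7] -/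
theorem bRank_dotProduct_pow_mulVec_le {m k : ℕ} (hk : 1 ≤ k) {N : Matrix (Fin m) (Fin m) (MvPolynomial σ K)}
    {b c : Fin m → MvPolynomial σ K} (hN : ∀ i j, (N i j).IsHomogeneous 1)
    (hb : ∀ j, (b j).IsHomogeneous 1) (hc : ∀ i, (c i).IsHomogeneous 1) :
    bRank k (b ⬝ᵥ (N ^ (2 * k - 2) *ᵥ c)) ≤ m := by
  have hsplit : b ⬝ᵥ (N ^ (2 * k - 2) *ᵥ c) = ∑ v, (b ᵥ* N ^ (k - 1)) v * (N ^ (k - 1) *ᵥ c) v := by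
    rw [show 2 * k - 2 = (k - 1) + (k - 1) by omega, pow_add, ← Matrix.mulVec_mulVec,
      Matrix.dotProduct_mulVec]
    rfl
  have h := bRank_le_of_eq_sum (k := k) _ _
    (fun v => by
      have h := isHomogeneous_vecMul (isHomogeneous_pow_apply hN (k - 1)) hb v
      rwa [show 1 + (k - 1) = k by omega] at h)
    (fun v => by
      have h := isHomogeneous_mulVec (isHomogeneous_pow_apply hN (k - 1)) hc v
      rwa [show (k - 1) + 1 = k by omega] at h)
    hsplit
  rwa [Fintype.card_fin] at h

/-- **Lemma 5.7 (ii)**: a middle term `(bᵀ N^j c) · e_{2k-2-j}` (`j < 2k-2`) has `brank ≤ 1` if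
`j + 2 = k` and `brank ≤ D^{k-1}` otherwise (split the longer factor along degree-`(k-t')`
monomials, `t' = min(j+2, 2k-2-j)`). [cite: Yabe2015, Lemma 5.7] -/
theorem bRank_middle_term_le [Fintype σ] {m k j : ℕ} (hj : j + 2 < 2 * k)
    {N : Matrix (Fin m) (Fin m) (MvPolynomial σ K)} {b c : Fin m → MvPolynomial σ K}
    (hN : ∀ i j, (N i j).IsHomogeneous 1) (hb : ∀ j, (b j).IsHomogeneous 1)
    (hc : ∀ i, (c i).IsHomogeneous 1) {e : MvPolynomial σ K} (he : e.IsHomogeneous (2 * k - 2 - j)) :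
    bRank k ((b ⬝ᵥ (N ^ j *ᵥ c)) * e) ≤ if j + 2 = k then 1 else Fintype.card σ ^ (k - 1) := by
  have hβ : (b ⬝ᵥ (N ^ j *ᵥ c)).IsHomogeneous (j + 2) := by
    have h := isHomogeneous_dotProduct hb (isHomogeneous_mulVec (isHomogeneous_pow_apply hN j) hc)
    rwa [show 1 + (j + 1) = j + 2 by omega] at h
  split_ifs with hjk
  · refine bRank_mul_le_one (by rwa [hjk] at hβ) ?_
    rwa [show 2 * k - 2 - j = k by omega] at he
  · rcases Nat.lt_or_ge (j + 2) k with hlt | hge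
    · exact (bRank_mul_le_card_degMonomials hβ he (by omega) hlt.le).trans
        (card_degMonomials_le_pow_of_le (by omega) (by omega))
    · rw [mul_comm]
      exact (bRank_mul_le_card_degMonomials he hβ (by omega) (by omega)).trans
        (card_degMonomials_le_pow_of_le (by omega) (by omega))

end Yabe

/-- **Yabe 2015, Proposition 5.2 — PROVED** (p0011, "the essence of our result"): for an `n × n`
matrix `A` of homogeneous linear forms in `D` variables and `k ≥ 1`,
`brank((det(A(x) + Λ_n^{n-1}))^{(2k)}) ≤ n + 2(k-1)D^{k-1}`. Proof: the decomposition
`Yabe.homogeneousComponent_det_add_lambdaDiag` (Lemmas 5.4–5.5 in algebraic form) and the term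
bounds `Yabe.bRank_dotProduct_pow_mulVec_le` (Lemma 5.7 (i)), `Yabe.bRank_middle_term_le`
(Lemma 5.7 (ii)), `Yabe.bRank_mul_le_card_degMonomials` (Lemma 5.6).
[cite: Yabe2015, Proposition 5.2] -/
theorem yabe2015_prop_5_2_holds : yabe2015_prop_5_2.{u, v} := by
  intro K _ σ _ _ n k A hk hA
  classical
  rcases n with _ | m
  · -- `n = 0`: the determinant is `1`, whose degree-`2k` part vanishes
    rw [Matrix.det_isEmpty, homogeneousComponent_of_mem (isHomogeneous_one σ K),
      if_neg (by omega), Yabe.bRank_zero]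
    exact Nat.zero_le _
  -- `n = m + 1`
  rw [show m + 1 - 1 = m from rfl]
  set N : Matrix (Fin m) (Fin m) (MvPolynomial σ K) := Matrix.of fun i j => A i.succ j.succ with hN
  set b : Fin m → MvPolynomial σ K := fun j => A 0 j.succ with hb
  set c : Fin m → MvPolynomial σ K := fun i => A i.succ 0 with hc
  have hN1 : ∀ i j, (N i j).IsHomogeneous 1 := fun i j => hA _ _
  have hb1 : ∀ j, (b j).IsHomogeneous 1 := fun j => hA _ _
  have hc1 : ∀ i, (c i).IsHomogeneous 1 := fun i => hA _ _
  rw [Yabe.homogeneousComponent_det_add_lambdaDiag hk A hA N (fun i j => rfl) b c (fun j => rfl)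
    (fun i => rfl)]
  set D := (1 + N).det with hD
  set T : ℕ → MvPolynomial σ K := fun j =>
    (b ⬝ᵥ (N ^ j *ᵥ c)) * homogeneousComponent (2 * k - 2 - j) D with hT
  -- homogeneity of the terms
  have hTa : (A 0 0 * homogeneousComponent (2 * k - 1) D).IsHomogeneous (2 * k) := by
    have h := (hA 0 0).mul (homogeneousComponent_isHomogeneous (2 * k - 1) D)
    rwa [show 1 + (2 * k - 1) = 2 * k by omega] at h
  have hTj : ∀ j ∈ Finset.range (2 * k - 1), (T j).IsHomogeneous (2 * k) := fun j hj => by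
    rw [Finset.mem_range] at hj
    have h := (Yabe.isHomogeneous_dotProduct hb1
      (Yabe.isHomogeneous_mulVec (Yabe.isHomogeneous_pow_apply hN1 j) hc1)).mul
      (homogeneousComponent_isHomogeneous (2 * k - 2 - j) D)
    rwa [show 1 + (j + 1) + (2 * k - 2 - j) = 2 * k by omega] at h
  have hCTj : ∀ j ∈ Finset.range (2 * k - 1), (C ((-1 : K) ^ j) * T j).IsHomogeneous (2 * k) :=
    fun j hj => by simpa using (isHomogeneous_C σ ((-1 : K) ^ j)).mul (hTj j hj)
  -- subadditivity
  have hsum : bRank k (∑ j ∈ Finset.range (2 * k - 1), C ((-1 : K) ^ j) * T j) ≤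
      ∑ j ∈ Finset.range (2 * k - 1), bRank k (T j) :=
    (Yabe.bRank_sum_le _ _ hCTj).trans (Finset.sum_le_sum fun j hj => Yabe.bRank_C_mul_le _ (hTj j hj))
  refine (Yabe.bRank_sub_le hTa (IsHomogeneous.sum _ _ _ hCTj)).trans ?_
  -- the `a · e_{2k-1}` term: `brank ≤ s_{k-1} ≤ D^{k-1}`
  have hTa_le : bRank k (A 0 0 * homogeneousComponent (2 * k - 1) D) ≤ Fintype.card σ ^ (k - 1) :=
    (Yabe.bRank_mul_le_card_degMonomials (hA 0 0) (homogeneousComponent_isHomogeneous (2 * k - 1) D)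
      (by omega) hk).trans (card_degMonomials_le_pow σ (k - 1))
  -- the top term `j = 2k - 2`: `brank ≤ n - 1`
  have htop : bRank k (T (2 * k - 2)) ≤ m := by
    show bRank k ((b ⬝ᵥ (N ^ (2 * k - 2) *ᵥ c)) * homogeneousComponent (2 * k - 2 - (2 * k - 2)) D) ≤ m
    rw [show 2 * k - 2 - (2 * k - 2) = 0 by omega, hD, Yabe.homogeneousComponent_zero_det_one_add hN1,
      mul_one]
    exact Yabe.bRank_dotProduct_pow_mulVec_le hk hN1 hb1 hc1
  -- the other terms
  have hmid : ∀ j, j + 2 < 2 * k →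
      bRank k (T j) ≤ if j + 2 = k then 1 else Fintype.card σ ^ (k - 1) := fun j hj =>
    Yabe.bRank_middle_term_le hj hN1 hb1 hc1 (homogeneousComponent_isHomogeneous _ D)
  refine (Nat.add_le_add hTa_le hsum).trans ?_
  rcases Nat.lt_or_ge k 2 with hk1 | hk2
  · -- `k = 1`: the sum is the single top term
    obtain rfl : k = 1 := by omega
    have h1 : ∑ j ∈ Finset.range (2 * 1 - 1), bRank 1 (T j) = bRank 1 (T (2 * 1 - 2)) := by
      rw [show 2 * 1 - 1 = 1 from rfl, Finset.sum_range_one]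
    rw [h1]
    have := htop
    simp only [Nat.sub_self, pow_zero, mul_zero, zero_mul, add_zero] at this ⊢
    omega
  · -- `k ≥ 2`: peel off `j = 2k - 2` (`≤ n - 1`) and `j = k - 2` (`≤ 1`); the other `2k - 3` terms
    -- are `≤ D^{k-1}` each
    have hmem1 : 2 * k - 2 ∈ Finset.range (2 * k - 1) := Finset.mem_range.2 (by omega)
    have hmem2 : k - 2 ∈ (Finset.range (2 * k - 1)).erase (2 * k - 2) :=
      Finset.mem_erase.2 ⟨by omega, Finset.mem_range.2 (by omega)⟩
    rw [← Finset.add_sum_erase _ _ hmem1, ← Finset.add_sum_erase _ _ hmem2]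
    have hk2' : bRank k (T (k - 2)) ≤ 1 := by
      have h := hmid (k - 2) (by omega)
      rwa [if_pos (by omega)] at h
    have hrest : ∑ j ∈ ((Finset.range (2 * k - 1)).erase (2 * k - 2)).erase (k - 2), bRank k (T j) ≤
        (2 * k - 3) * Fintype.card σ ^ (k - 1) := by
      have hcard : (((Finset.range (2 * k - 1)).erase (2 * k - 2)).erase (k - 2)).card = 2 * k - 3 := by
        rw [Finset.card_erase_of_mem hmem2, Finset.card_erase_of_mem hmem1, Finset.card_range]
        omega
      have h := Finset.sum_le_card_nsmul
        (((Finset.range (2 * k - 1)).erase (2 * k - 2)).erase (k - 2)) (fun j => bRank k (T j))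
        (Fintype.card σ ^ (k - 1))
        (fun j hj => by
          obtain ⟨hj1, hj2⟩ := Finset.mem_erase.1 hj
          obtain ⟨hj3, hj4⟩ := Finset.mem_erase.1 hj2
          rw [Finset.mem_range] at hj4
          have h := hmid j (by omega)
          rwa [if_neg (by omega)] at h)
      rwa [hcard, smul_eq_mul] at h
    have hsplit : 2 * (k - 1) * Fintype.card σ ^ (k - 1) =
        (2 * k - 3) * Fintype.card σ ^ (k - 1) + Fintype.card σ ^ (k - 1) := by
      rw [show 2 * (k - 1) = (2 * k - 3) + 1 by omega, Nat.add_mul, one_mul]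
    omega

end Literature.Computability.AlgebraicComplexity

end
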